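import Mathlib
import HarnessLib

/-!
# Weights `w_Q` for decoupling: the basic inequalities (PROVED)

Analysis/Fourier support file for the `ℓ²`-decoupling programme (everything **proved**; no named
facts). On `ι → ℝ` (sup norm, product Lebesgue measure; `d = card ι`) we study the weights
attached to a cube `Q` of centre `c` and side `R`,

  `w_{Q,E}(x) = wt c R E x = (1 + dist x c / R) ^ (-E)`,

of C. Demeter, *Fourier Restriction, Decoupling, and Applications* (CUP 2020), (9.6), and of
J. Bourgain–C. Demeter, *A study guide for the `l²` decoupling theorem* (2017), §1 and §4
(`w_{B,E}`), and prove the inequalities on which every weighted estimate of that theory rests: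

* `one_add_dist_div_le_mul` — Peetre's inequality `1 + |x-c|/R ≤ (1 + |x-m|/R)(1 + |m-c|/R)`,
  whence `wt_le_mul_wt_of_dist_le` (moving the point, or the centre, by `≤ A R` costs `(1+A)^E`),
  `wt_radius_mul_le` (changing the radius), `wt_antitone_exponent`;
* `integral_wt` — `∫ w_{Q,E} = R^d ∫ (1+‖z‖)^{-E} dz = R^d · wtMass ι E` (finite for `E > d`);
* `sum_wt_le_of_pairwiseDisjoint` — for any finite family of pairwise disjoint cubes of side `R`,
  `∑ w_{Δ,E}(x) ≤ (3/2)^E · wtMass` uniformly in `x` (comparison with the integral), and its lattice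
  forms `sum_wt_lattice_le`, `tsum_wt_lattice_le`;
* `(9.7)`: `one_le_mul_sum_wt_subbox` (`1_Q ≲ ∑_{Δ ⊂ Q} w_Δ`) and `sum_wt_subbox_le`
  (`∑_{Δ ⊂ Q} w_Δ ≲ w_Q`) for the partition of a cube of side `N R` into `N^d` cubes of side `R`;
* `(7.5)`: `wt_le_mul_wt_center_of_mem_box` (`w_Q ≲ ∑_{Q'} 1_{Q'} w_Q(c_{Q'})`) and
  `sum_wt_mul_wt_center_le` / `tsum_wt_mul_wt_center_le` (`∑_{Q'} w_{Q'}(x) w_Q(c_{Q'}) ≲ w_Q(x)`)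
  for the tiling of `ℝ^d` by the lattice cubes `latticeBox a R k`, `k ∈ ℤ^d`;
* the same inequalities integrated against an arbitrary measurable `G ≥ 0`
  (`lintegral_box_le_sum`, `sum_lintegral_wt_subbox_le`, `lintegral_wt_le_tsum`,
  `tsum_wt_center_mul_lintegral_le`), and from them **Demeter's Lemma 9.12** (= Lemma 4.1 of
  the study guide) in the concrete form of his Remark 9.13: `lintegral_wt_le_of_forall_latticeBox`
  — if `∫_{Q'} Φ ≤ C (∑_i (∫ Ψ_i w_{Q'})^{2/p})^{p/2}` for the lattice cubes `Q'` of side `R`, then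
  `∫ Φ w_Q ≤ K C (∑_i (∫ Ψ_i w_Q)^{2/p})^{p/2}` for every cube `Q` of side `R` (`p ≥ 2`), via
  Minkowski's inequality in `ℓ^{p/2}(ℤ^d)` (`rpow_sum_sum_le`).

All constants are explicit functions of `E` and `d` only (never of `R`, `N`, `x`). This is the
weights layer of the planned proof of `ℓ²` decoupling for the parabola (Demeter, op. cit., §10.2)
feeding hypothesis `h210` of `Literature.NumberTheory.LFunctions.Bourgain2017_theorem4_log`
(`BourgainTheorem4Frontier.lean`).

## References

* C. Demeter, *Fourier Restriction, Decoupling, and Applications*, Cambridge Studies in Advanced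
  Mathematics 184, Cambridge Univ. Press 2020 — (7.5), (9.6), (9.7), Lemma 9.12. [Demeter2019]
* J. Bourgain, C. Demeter, *A study guide for the l² decoupling theorem*, Chin. Ann. Math. Ser. B
  38 (2017) 173–200 = arXiv:1604.06032 — §4, (4.1), Lemma 4.1. [BourgainDemeter2016]
-/

noncomputable section

open MeasureTheory Real Set Metric Filter Finset Function
open scoped ENNReal NNReal Topology

namespace Literature.Analysis.Fourier
namespace DecouplingWeights

variable {ι : Type*}

/-! ### Boxes (no finiteness needed) -/

/-- The half-open box (cube) with lower corner `a` and side `R`. [folklore] -/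
def box (a : ι → ℝ) (R : ℝ) : Set (ι → ℝ) := Set.pi Set.univ fun i => Ico (a i) (a i + R)

/-- Its centre. [folklore] -/
def boxCenter (a : ι → ℝ) (R : ℝ) : ι → ℝ := fun i => a i + R / 2

/-- Membership in a box, coordinatewise. [folklore] -/
theorem mem_box {a : ι → ℝ} {R : ℝ} {x : ι → ℝ} : x ∈ box a R ↔ ∀ i, a i ≤ x i ∧ x i < a i + R := by
  simp [box, Set.mem_pi]

/-- A box is contained in the closed box with the same corners. [folklore] -/
theorem box_subset_Icc (a : ι → ℝ) (R : ℝ) : box a R ⊆ Set.Icc a (a + R • (1 : ι → ℝ)) := by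
  intro x hx
  simp only [Set.mem_Icc]
  refine ⟨fun i => (mem_box.1 hx i).1, fun i => ?_⟩
  simpa using (mem_box.1 hx i).2.le

/-- Lower corner of the lattice box of index `k ∈ ℤ^d` (offset `a`, side `R`). [folklore] -/
def latticeCorner (a : ι → ℝ) (R : ℝ) (k : ι → ℤ) : ι → ℝ := fun i => a i + R * k i

/-- The lattice box of index `k`. [folklore] -/
def latticeBox (a : ι → ℝ) (R : ℝ) (k : ι → ℤ) : Set (ι → ℝ) := box (latticeCorner a R k) R

/-- Its centre. [folklore] -/
def latticeCenter (a : ι → ℝ) (R : ℝ) (k : ι → ℤ) : ι → ℝ := boxCenter (latticeCorner a R k) R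

/-- The index of the lattice box containing `x`. [folklore] -/
def latticeIndex (a : ι → ℝ) (R : ℝ) (x : ι → ℝ) : ι → ℤ := fun i => ⌊(x i - a i) / R⌋

/-- `x` lies in the lattice box of index `k` iff `k` is the coordinatewise floor of `(x-a)/R`. [folklore] -/
theorem mem_latticeBox_iff {a : ι → ℝ} {R : ℝ} (hR : 0 < R) {k : ι → ℤ} {x : ι → ℝ} :
    x ∈ latticeBox a R k ↔ latticeIndex a R x = k := by
  rw [latticeBox, mem_box, funext_iff]
  refine forall_congr' fun i => ?_
  simp only [latticeIndex, latticeCorner]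
  rw [Int.floor_eq_iff, le_div_iff₀ hR, div_lt_iff₀ hR]
  constructor
  · rintro ⟨h1, h2⟩; constructor <;> linarith
  · rintro ⟨h1, h2⟩; constructor <;> linarith

/-- Every point lies in the lattice box of its index. [folklore] -/
theorem mem_latticeBox_latticeIndex {a : ι → ℝ} {R : ℝ} (hR : 0 < R) (x : ι → ℝ) :
    x ∈ latticeBox a R (latticeIndex a R x) :=
  (mem_latticeBox_iff hR).2 rfl

/-- Distinct lattice boxes are disjoint. [folklore] -/
theorem pairwise_disjoint_latticeBox {a : ι → ℝ} {R : ℝ} (hR : 0 < R) :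
    Pairwise (Disjoint on latticeBox a R) := by
  intro k k' hkk'
  refine Set.disjoint_left.2 fun x hx hx' => hkk' ?_
  rw [mem_latticeBox_iff hR] at hx hx'
  rw [← hx, ← hx']

/-- The lattice boxes cover the space. [folklore] -/
theorem iUnion_latticeBox {a : ι → ℝ} {R : ℝ} (hR : 0 < R) : ⋃ k, latticeBox a R k = Set.univ :=
  Set.eq_univ_of_forall fun x => Set.mem_iUnion.2 ⟨_, mem_latticeBox_latticeIndex hR x⟩

/-- Lattice corners determine the index. [folklore] -/
theorem latticeCorner_injective {a : ι → ℝ} {R : ℝ} (hR : 0 < R) :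
    Function.Injective (latticeCorner a R) := by
  intro k k' h
  funext i
  have := congr_fun h i
  simp only [latticeCorner, add_right_inj, mul_eq_mul_left_iff, Int.cast_inj, hR.ne', or_false]
    at this
  exact this

/-- Lower corner of the sub-box of index `k ∈ {0,…,N-1}^d` of the box of corner `a` and side
`N R`. [folklore] -/
def subboxCorner (a : ι → ℝ) (R : ℝ) (N : ℕ) (k : ι → Fin N) : ι → ℝ := fun i => a i + R * (k i : ℕ)

/-- The sub-box of index `k`. [folklore] -/
def subbox (a : ι → ℝ) (R : ℝ) (N : ℕ) (k : ι → Fin N) : Set (ι → ℝ) := box (subboxCorner a R N k) R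

/-- Its centre. [folklore] -/
def subboxCenter (a : ι → ℝ) (R : ℝ) (N : ℕ) (k : ι → Fin N) : ι → ℝ :=
  boxCenter (subboxCorner a R N k) R

/-- Sub-boxes are lattice boxes. [folklore] -/
theorem subboxCorner_eq_latticeCorner (a : ι → ℝ) (R : ℝ) (N : ℕ) (k : ι → Fin N) :
    subboxCorner a R N k = latticeCorner a R (fun i => ((k i : ℕ) : ℤ)) := by
  funext i; simp [subboxCorner, latticeCorner]

/-- Centres of sub-boxes are lattice centres. [folklore] -/
theorem subboxCenter_eq_latticeCenter (a : ι → ℝ) (R : ℝ) (N : ℕ) (k : ι → Fin N) :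
    subboxCenter a R N k = latticeCenter a R (fun i => ((k i : ℕ) : ℤ)) := by
  simp only [subboxCenter, latticeCenter, subboxCorner_eq_latticeCorner]

/-- Each sub-box lies in the big box. [folklore] -/
theorem subbox_subset_box {a : ι → ℝ} {R : ℝ} (hR : 0 ≤ R) {N : ℕ} (k : ι → Fin N) :
    subbox a R N k ⊆ box a (N * R) := by
  intro x hx
  rw [subbox, mem_box] at hx
  rw [mem_box]
  intro i
  obtain ⟨h1, h2⟩ := hx i
  simp only [subboxCorner] at h1 h2
  have hk : ((k i : ℕ) : ℝ) + 1 ≤ N := by exact_mod_cast (k i).isLt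
  have h0 : (0 : ℝ) ≤ (k i : ℕ) := Nat.cast_nonneg _
  constructor
  · nlinarith
  · nlinarith

/-- The sub-boxes cover the big box. [folklore] -/
theorem exists_mem_subbox {a : ι → ℝ} {R : ℝ} (hR : 0 < R) {N : ℕ} {x : ι → ℝ}
    (hx : x ∈ box a (N * R)) : ∃ k : ι → Fin N, x ∈ subbox a R N k := by
  have hk : ∀ i, ⌊(x i - a i) / R⌋₊ < N := by
    intro i
    obtain ⟨h1, h2⟩ := mem_box.1 hx i
    rw [Nat.floor_lt (div_nonneg (by linarith) hR.le), div_lt_iff₀ hR]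
    linarith
  refine ⟨fun i => ⟨_, hk i⟩, ?_⟩
  rw [subbox, mem_box]
  intro i
  obtain ⟨h1, h2⟩ := mem_box.1 hx i
  have hnn : 0 ≤ (x i - a i) / R := div_nonneg (by linarith) hR.le
  have hf1 := Nat.floor_le hnn
  have hf2 := Nat.lt_floor_add_one ((x i - a i) / R)
  rw [le_div_iff₀ hR] at hf1
  rw [div_lt_iff₀ hR] at hf2
  simp only [subboxCorner]
  constructor <;> nlinarith

/-- Distinct sub-boxes are disjoint. [folklore] -/
theorem pairwise_disjoint_subbox {a : ι → ℝ} {R : ℝ} (hR : 0 < R) (N : ℕ) :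
    Pairwise (Disjoint on subbox a R N) := by
  intro k k' hkk'
  have hne : (fun i => ((k i : ℕ) : ℤ)) ≠ fun i => ((k' i : ℕ) : ℤ) := by
    intro h; apply hkk'; funext i
    have := congr_fun h i
    exact Fin.ext (by exact_mod_cast this)
  have := pairwise_disjoint_latticeBox (a := a) hR hne
  simpa [Function.onFun, subbox, latticeBox, subboxCorner_eq_latticeCorner] using this

variable [Fintype ι]

/-- Boxes are measurable. [folklore] -/
theorem measurableSet_box (a : ι → ℝ) (R : ℝ) : MeasurableSet (box a R) :=
  MeasurableSet.univ_pi fun _ => measurableSet_Ico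

/-- Lattice boxes are measurable. [folklore] -/
theorem measurableSet_latticeBox (a : ι → ℝ) (R : ℝ) (k : ι → ℤ) :
    MeasurableSet (latticeBox a R k) :=
  measurableSet_box _ _

/-- Sub-boxes are measurable. [folklore] -/
theorem measurableSet_subbox (a : ι → ℝ) (R : ℝ) (N : ℕ) (k : ι → Fin N) :
    MeasurableSet (subbox a R N k) :=
  measurableSet_box _ _

/-- The volume of a box of side `R` is `R^d`. [folklore] -/
theorem volume_box {R : ℝ} (hR : 0 ≤ R) (a : ι → ℝ) :
    volume (box a R) = ENNReal.ofReal (R ^ Fintype.card ι) := by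
  rw [box, Real.volume_pi_Ico]
  simp only [add_sub_cancel_left, Finset.prod_const, Finset.card_univ]
  rw [ENNReal.ofReal_pow hR]

/-- The volume of a box of side `R` is `R^d` (real form). [folklore] -/
theorem volume_box_toReal {R : ℝ} (hR : 0 ≤ R) (a : ι → ℝ) :
    (volume (box a R)).toReal = R ^ Fintype.card ι := by
  rw [volume_box hR, ENNReal.toReal_ofReal (pow_nonneg hR _)]

/-- Points of a box are within `R/2` of its centre (sup metric). [folklore] -/
theorem dist_boxCenter_le {a x : ι → ℝ} {R : ℝ} (hR : 0 ≤ R) (hx : x ∈ box a R) :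
    dist x (boxCenter a R) ≤ R / 2 := by
  rw [dist_pi_le_iff (by positivity)]
  intro i
  obtain ⟨h1, h2⟩ := mem_box.1 hx i
  rw [Real.dist_eq, abs_le]
  simp only [boxCenter]
  constructor <;> linarith

/-- Points of a box are within `R/2` of its centre (sup metric), product form. [folklore] -/
theorem dist_boxCenter_le' {a x : ι → ℝ} {R : ℝ} (hR : 0 ≤ R) (hx : x ∈ box a R) :
    dist x (boxCenter a R) ≤ (1 / 2) * R := by
  have := dist_boxCenter_le hR hx
  linarith

/-- Distance from a sub-box centre to the centre of the big box. [folklore] -/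
theorem dist_subboxCenter_boxCenter_le {R : ℝ} (hR : 0 ≤ R) {N : ℕ} (hN : 0 < N) (a : ι → ℝ)
    (k : ι → Fin N) : dist (subboxCenter a R N k) (boxCenter a (N * R)) ≤ N * R / 2 := by
  rw [dist_pi_le_iff (by positivity)]
  intro i
  rw [Real.dist_eq, abs_le]
  simp only [subboxCenter, boxCenter, subboxCorner]
  have hk : ((k i : ℕ) : ℝ) + 1 ≤ N := by exact_mod_cast (k i).isLt
  have h0 : (0 : ℝ) ≤ (k i : ℕ) := Nat.cast_nonneg _
  have hN1 : (1 : ℝ) ≤ N := by exact_mod_cast hN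
  constructor <;> nlinarith

/-! ### The weights -/

/-- The decoupling weight of centre `c`, radius (side) `R` and exponent `E`:
`wt c R E x = (1 + dist x c / R) ^ (-E)` ((9.6) of Demeter's book, with a free exponent;
`w_{B,E}` of the study guide). [cite: Demeter2019, (9.6)] -/
def wt (c : ι → ℝ) (R E : ℝ) (x : ι → ℝ) : ℝ := (1 + dist x c / R) ^ (-E)

/-- Unfolding the weight. [folklore] -/
theorem wt_def (c : ι → ℝ) (R E : ℝ) (x : ι → ℝ) : wt c R E x = (1 + dist x c / R) ^ (-E) := rfl

/-- The base of the weight is positive. [folklore] -/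
theorem one_add_dist_div_pos {R : ℝ} (hR : 0 < R) (x c : ι → ℝ) : 0 < 1 + dist x c / R := by
  positivity

/-- The base of the weight is at least `1`. [folklore] -/
theorem one_le_one_add_dist_div {R : ℝ} (hR : 0 < R) (x c : ι → ℝ) : 1 ≤ 1 + dist x c / R :=
  le_add_of_nonneg_right (by positivity)

/-- Weights are positive. [folklore] -/
theorem wt_pos {R : ℝ} (hR : 0 < R) (c : ι → ℝ) (E : ℝ) (x : ι → ℝ) : 0 < wt c R E x :=
  Real.rpow_pos_of_pos (one_add_dist_div_pos hR x c) _

/-- Weights are nonnegative. [folklore] -/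
theorem wt_nonneg {R : ℝ} (hR : 0 < R) (c : ι → ℝ) (E : ℝ) (x : ι → ℝ) : 0 ≤ wt c R E x :=
  (wt_pos hR c E x).le

/-- Weights are at most `1` (nonnegative exponent). [folklore] -/
theorem wt_le_one {R E : ℝ} (hR : 0 < R) (hE : 0 ≤ E) (c x : ι → ℝ) : wt c R E x ≤ 1 :=
  Real.rpow_le_one_of_one_le_of_nonpos (one_le_one_add_dist_div hR x c) (neg_nonpos.mpr hE)

/-- The weight is `1` at the centre. [folklore] -/
@[simp] theorem wt_self (c : ι → ℝ) (R E : ℝ) : wt c R E c = 1 := by simp [wt]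

/-- The weight is symmetric in point and centre. [folklore] -/
theorem wt_comm (c : ι → ℝ) (R E : ℝ) (x : ι → ℝ) : wt c R E x = wt x R E c := by
  rw [wt, wt, dist_comm]

/-- Lower bound near the centre: `dist x c ≤ A R ⟹ (1+A)^{-E} ≤ w(x)`. [folklore] -/
theorem rpow_neg_le_wt_of_dist_le {R E A : ℝ} (hR : 0 < R) (hE : 0 ≤ E) {c x : ι → ℝ}
    (h : dist x c ≤ A * R) : (1 + A) ^ (-E) ≤ wt c R E x := by
  refine Real.rpow_le_rpow_of_nonpos (one_add_dist_div_pos hR x c) ?_ (neg_nonpos.mpr hE)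
  have : dist x c / R ≤ A := by rwa [div_le_iff₀ hR]
  linarith

/-- **Peetre's inequality** for the base of the weights. [folklore] -/
theorem one_add_dist_div_le_mul {R : ℝ} (hR : 0 < R) (x m c : ι → ℝ) :
    1 + dist x c / R ≤ (1 + dist x m / R) * (1 + dist m c / R) := by
  have ht : dist x c ≤ dist x m + dist m c := dist_triangle x m c
  have h1 : dist x c / R ≤ dist x m / R + dist m c / R := by
    rw [← add_div]; exact div_le_div_of_nonneg_right ht hR.le
  have h2 : 0 ≤ dist x m / R * (dist m c / R) := by positivity
  nlinarith

/-- Moving the point by at most `A R` changes the weight by at most `(1+A)^E`: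
`dist x y ≤ A R ⟹ w_c(x) ≤ (1+A)^E w_c(y)`. By `wt_comm` the same holds for moving the centre.
[cite: Demeter2019, (7.5)] -/
theorem wt_le_mul_wt_of_dist_le {R E A : ℝ} (hR : 0 < R) (hE : 0 ≤ E) (hA : 0 ≤ A) (c : ι → ℝ)
    {x y : ι → ℝ} (h : dist x y ≤ A * R) : wt c R E x ≤ (1 + A) ^ E * wt c R E y := by
  have hP := one_add_dist_div_le_mul hR y x c
  have hxy : 1 + dist y x / R ≤ 1 + A := by
    rw [dist_comm] at h
    have : dist y x / R ≤ A := by rwa [div_le_iff₀ hR]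
    linarith
  have hb : 1 + dist y c / R ≤ (1 + A) * (1 + dist x c / R) :=
    hP.trans (mul_le_mul_of_nonneg_right hxy (one_add_dist_div_pos hR x c).le)
  have key : ((1 + A) * (1 + dist x c / R)) ^ (-E) ≤ wt c R E y :=
    Real.rpow_le_rpow_of_nonpos (one_add_dist_div_pos hR y c) hb (neg_nonpos.mpr hE)
  rw [Real.mul_rpow (by positivity) (one_add_dist_div_pos hR x c).le] at key
  have hA' : 0 ≤ (1 + A) ^ E := Real.rpow_nonneg (by positivity) _
  calc wt c R E x = (1 + A) ^ E * ((1 + A) ^ (-E) * wt c R E x) := by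
        rw [← mul_assoc, ← Real.rpow_add (by positivity), add_neg_cancel, Real.rpow_zero, one_mul]
    _ ≤ (1 + A) ^ E * wt c R E y := mul_le_mul_of_nonneg_left key hA'

/-- Moving the centre: `dist c c' ≤ A R ⟹ w_{c}(x) ≤ (1+A)^E w_{c'}(x)`. [cite: Demeter2019, (7.5)] -/
theorem wt_le_mul_wt_of_dist_center_le {R E A : ℝ} (hR : 0 < R) (hE : 0 ≤ E) (hA : 0 ≤ A)
    {c c' : ι → ℝ} (h : dist c c' ≤ A * R) (x : ι → ℝ) :
    wt c R E x ≤ (1 + A) ^ E * wt c' R E x := by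
  rw [wt_comm c, wt_comm c']
  exact wt_le_mul_wt_of_dist_le hR hE hA x h

/-- Larger radius, larger weight. [folklore] -/
theorem wt_mono_radius {R R' E : ℝ} (hR : 0 < R) (hRR' : R ≤ R') (hE : 0 ≤ E) (c x : ι → ℝ) :
    wt c R E x ≤ wt c R' E x := by
  refine Real.rpow_le_rpow_of_nonpos (one_add_dist_div_pos (hR.trans_le hRR') x c) ?_
    (neg_nonpos.mpr hE)
  gcongr

/-- Enlarging the radius by `A ≥ 1` costs at most `A^E`. [folklore] -/
theorem wt_radius_mul_le {R E A : ℝ} (hR : 0 < R) (hA : 1 ≤ A) (hE : 0 ≤ E) (c x : ι → ℝ) :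
    wt c (A * R) E x ≤ A ^ E * wt c R E x := by
  have hA0 : 0 < A := one_pos.trans_le hA
  have hb : 1 + dist x c / R ≤ A * (1 + dist x c / (A * R)) := by
    have e : A * (1 + dist x c / (A * R)) = A + dist x c / R := by
      field_simp
    rw [e]
    linarith
  have key : (A * (1 + dist x c / (A * R))) ^ (-E) ≤ wt c R E x :=
    Real.rpow_le_rpow_of_nonpos (one_add_dist_div_pos hR x c) hb (neg_nonpos.mpr hE)
  rw [Real.mul_rpow hA0.le (one_add_dist_div_pos (mul_pos hA0 hR) x c).le] at key
  calc wt c (A * R) E x = A ^ E * (A ^ (-E) * wt c (A * R) E x) := by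
        rw [← mul_assoc, ← Real.rpow_add hA0, add_neg_cancel, Real.rpow_zero, one_mul]
    _ ≤ A ^ E * wt c R E x := mul_le_mul_of_nonneg_left key (Real.rpow_nonneg hA0.le _)

/-- Larger exponent, smaller weight. [folklore] -/
theorem wt_antitone_exponent {R E E' : ℝ} (hR : 0 < R) (h : E ≤ E') (c x : ι → ℝ) :
    wt c R E' x ≤ wt c R E x :=
  Real.rpow_le_rpow_of_exponent_le (one_le_one_add_dist_div hR x c) (neg_le_neg h)

/-- Weights are continuous. [folklore] -/
theorem continuous_wt {R : ℝ} (hR : 0 < R) (c : ι → ℝ) (E : ℝ) : Continuous (wt c R E) := by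
  refine Continuous.rpow_const (by fun_prop) fun x => Or.inl (one_add_dist_div_pos hR x c).ne'

/-- Weights are measurable. [folklore] -/
theorem measurable_wt {R : ℝ} (hR : 0 < R) (c : ι → ℝ) (E : ℝ) : Measurable (wt c R E) :=
  (continuous_wt hR c E).measurable

/-- The weight as a rescaled translate of `z ↦ (1+‖z‖)^{-E}`. [folklore] -/
theorem wt_eq_comp {R : ℝ} (hR : 0 < R) (c : ι → ℝ) (E : ℝ) (x : ι → ℝ) :
    wt c R E x = (fun z : ι → ℝ => (1 + ‖z‖) ^ (-E)) (R⁻¹ • (x - c)) := by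
  simp only [wt, dist_eq_norm, norm_smul, norm_inv, Real.norm_of_nonneg hR.le, div_eq_inv_mul]

/-- `wtMass ι E = ∫ (1+‖z‖)^{-E} dz` over `ι → ℝ` (finite for `E > d`). [folklore] -/
def wtMass (ι : Type*) [Fintype ι] (E : ℝ) : ℝ := ∫ z : ι → ℝ, (1 + ‖z‖) ^ (-E)

/-- `wtMass` is nonnegative. [folklore] -/
theorem wtMass_nonneg (E : ℝ) : 0 ≤ wtMass ι E :=
  integral_nonneg fun z => Real.rpow_nonneg (by positivity) _

/-- `(1+‖z‖)^{-E}` is integrable for `E > d` (Mathlib's `integrable_one_add_norm`). [folklore] -/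
theorem integrable_one_add_norm_rpow_neg {E : ℝ} (hE : (Fintype.card ι : ℝ) < E) :
    Integrable (fun z : ι → ℝ => (1 + ‖z‖) ^ (-E)) := by
  have := integrable_one_add_norm (E := ι → ℝ) (μ := volume) (r := E) (by simpa using hE)
  simpa using this

/-- Weights of exponent `E > d` are integrable. [folklore] -/
theorem integrable_wt {R E : ℝ} (hR : 0 < R) (hE : (Fintype.card ι : ℝ) < E) (c : ι → ℝ) :
    Integrable (wt c R E) := by
  have h1 : Integrable (fun x : ι → ℝ => (fun z : ι → ℝ => (1 + ‖z‖) ^ (-E)) (R⁻¹ • x)) :=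
    (integrable_one_add_norm_rpow_neg hE).comp_smul (inv_ne_zero hR.ne')
  have h2 := h1.comp_sub_right c
  refine h2.congr (Eventually.of_forall fun x => ?_)
  simp only [wt_eq_comp hR]

/-- `∫ w_{Q,E} = R^d · wtMass`. [folklore] -/
theorem integral_wt {R E : ℝ} (hR : 0 < R) (c : ι → ℝ) :
    ∫ x, wt c R E x = R ^ Fintype.card ι * wtMass ι E := by
  simp_rw [wt_eq_comp hR]
  rw [integral_sub_right_eq_self (μ := volume)
    (fun x => (fun z : ι → ℝ => (1 + ‖z‖) ^ (-E)) (R⁻¹ • x)) c]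
  rw [Measure.integral_comp_inv_smul_of_nonneg volume (fun z : ι → ℝ => (1 + ‖z‖) ^ (-E)) hR.le]
  simp [wtMass, smul_eq_mul]

/-- Weights are integrable on boxes (any exponent). [folklore] -/
theorem integrableOn_wt_box {R : ℝ} (hR : 0 < R) (c : ι → ℝ) (E : ℝ) (a : ι → ℝ) (R' : ℝ) :
    IntegrableOn (wt c R E) (box a R') := by
  refine IntegrableOn.mono_set ?_ (box_subset_Icc a R')
  exact (continuous_wt hR c E).continuousOn.integrableOn_compact isCompact_Icc

/-! ### Two points of the same box; a box against a weight -/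

/-- For `x, y` in one box of side `R`: `w_c(x) ≤ 2^E w_c(y)` (any centre `c`, radius `R`).
[cite: Demeter2019, (7.5)] -/
theorem wt_le_mul_wt_of_mem_box {R E : ℝ} (hR : 0 < R) (hE : 0 ≤ E) (c : ι → ℝ) {a x y : ι → ℝ}
    (hx : x ∈ box a R) (hy : y ∈ box a R) : wt c R E x ≤ 2 ^ E * wt c R E y := by
  have h : dist x y ≤ 1 * R := by
    calc dist x y ≤ dist x (boxCenter a R) + dist y (boxCenter a R) := dist_triangle_right _ _ _
      _ ≤ R / 2 + R / 2 := add_le_add (dist_boxCenter_le hR.le hx) (dist_boxCenter_le hR.le hy)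
      _ = 1 * R := by ring
  have := wt_le_mul_wt_of_dist_le hR hE zero_le_one c h
  norm_num at this
  exact this

/-- `(7.5)`, first half: for `x` in the box of side `R` and centre `c'`, and any centre `c`,
`w_c(x) ≤ (3/2)^E w_c(c')`. [cite: Demeter2019, (7.5)] -/
theorem wt_le_mul_wt_center_of_mem_box {R E : ℝ} (hR : 0 < R) (hE : 0 ≤ E) (c : ι → ℝ)
    {a x : ι → ℝ} (hx : x ∈ box a R) : wt c R E x ≤ (3 / 2) ^ E * wt c R E (boxCenter a R) := by
  have := wt_le_mul_wt_of_dist_le hR hE (by norm_num : (0 : ℝ) ≤ 1 / 2) c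
    (dist_boxCenter_le' hR.le hx)
  norm_num at this ⊢
  exact this

/-- ... and conversely `w_c(c') ≤ (3/2)^E w_c(x)`. [cite: Demeter2019, (7.5)] -/
theorem wt_center_le_mul_wt_of_mem_box {R E : ℝ} (hR : 0 < R) (hE : 0 ≤ E) (c : ι → ℝ)
    {a x : ι → ℝ} (hx : x ∈ box a R) : wt c R E (boxCenter a R) ≤ (3 / 2) ^ E * wt c R E x := by
  have h := dist_boxCenter_le' hR.le hx
  rw [dist_comm] at h
  have := wt_le_mul_wt_of_dist_le hR hE (by norm_num : (0 : ℝ) ≤ 1 / 2) c h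
  norm_num at this ⊢
  exact this

/-- **Comparison with the integral.** `R^d · w_Δ(x) ≤ (3/2)^E ∫_Δ (1 + dist x y / R)^{-E} dy`
for the box `Δ` of corner `a` and side `R`. [folklore] -/
theorem wt_center_mul_le_setIntegral {R E : ℝ} (hR : 0 < R) (hE : 0 ≤ E) (a x : ι → ℝ) :
    R ^ Fintype.card ι * wt (boxCenter a R) R E x ≤ (3 / 2) ^ E * ∫ y in box a R, wt x R E y := by
  have hpt : ∀ y ∈ box a R, wt (boxCenter a R) R E x ≤ (3 / 2) ^ E * wt x R E y := by
    intro y hy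
    rw [wt_comm (boxCenter a R)]
    exact wt_center_le_mul_wt_of_mem_box hR hE x hy
  have hvol : volume (box a R) ≠ ∞ := by rw [volume_box hR.le]; exact ENNReal.ofReal_ne_top
  have hconst : ∫ _ in box a R, wt (boxCenter a R) R E x =
      R ^ Fintype.card ι * wt (boxCenter a R) R E x := by
    rw [setIntegral_const, measureReal_def, volume_box_toReal hR.le, smul_eq_mul]
  have hmono : ∫ _ in box a R, wt (boxCenter a R) R E x ≤ ∫ y in box a R, (3 / 2) ^ E * wt x R E y :=
    setIntegral_mono_on (integrableOn_const hvol) ((integrableOn_wt_box hR x E a R).const_mul _)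
      (measurableSet_box a R) hpt
  rw [integral_const_mul] at hmono
  rw [← hconst]
  exact hmono

/-- **Uniform bound for disjoint families.** If the boxes `box a R`, `a ∈ U`, are pairwise
disjoint then `∑_{a ∈ U} w_{Δ_a,E}(x) ≤ (3/2)^E · wtMass ι E` for every `x` (`E > d`).
[cite: Demeter2019, (9.7)] -/
theorem sum_wt_le_of_pairwiseDisjoint {R E : ℝ} (hR : 0 < R) (hE : (Fintype.card ι : ℝ) < E)
    (U : Finset (ι → ℝ)) (hU : (U : Set (ι → ℝ)).PairwiseDisjoint fun a => box a R) (x : ι → ℝ) :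
    ∑ a ∈ U, wt (boxCenter a R) R E x ≤ (3 / 2) ^ E * wtMass ι E := by
  have hE0 : 0 ≤ E := ((Nat.cast_nonneg _).trans_lt hE).le
  have hRd : 0 < R ^ Fintype.card ι := pow_pos hR _
  have hint : Integrable (wt x R E) := integrable_wt hR hE x
  have h1 : ∑ a ∈ U, R ^ Fintype.card ι * wt (boxCenter a R) R E x ≤
      ∑ a ∈ U, (3 / 2) ^ E * ∫ y in box a R, wt x R E y :=
    Finset.sum_le_sum fun a _ => wt_center_mul_le_setIntegral hR hE0 a x
  have h2 : ∑ a ∈ U, ∫ y in box a R, wt x R E y = ∫ y in ⋃ a ∈ U, box a R, wt x R E y :=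
    (integral_biUnion_finset U (fun a _ => measurableSet_box a R) hU
      (fun a _ => hint.integrableOn)).symm
  have h3 : ∫ y in ⋃ a ∈ U, box a R, wt x R E y ≤ ∫ y, wt x R E y :=
    setIntegral_le_integral hint (Eventually.of_forall fun y => wt_nonneg hR x E y)
  rw [integral_wt hR x] at h3
  rw [← Finset.mul_sum, ← Finset.mul_sum, h2] at h1
  have h4 : R ^ Fintype.card ι * ∑ a ∈ U, wt (boxCenter a R) R E x ≤
      R ^ Fintype.card ι * ((3 / 2) ^ E * wtMass ι E) := by
    calc _ ≤ (3 / 2) ^ E * ∫ y in ⋃ a ∈ U, box a R, wt x R E y := h1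
      _ ≤ (3 / 2) ^ E * (R ^ Fintype.card ι * wtMass ι E) :=
          mul_le_mul_of_nonneg_left h3 (Real.rpow_nonneg (by norm_num) _)
      _ = _ := by ring
  exact le_of_mul_le_mul_left h4 hRd

/-! ### Lattice sums -/

/-- Finite lattice sums of weights are uniformly bounded. [cite: Demeter2019, (9.7)] -/
theorem sum_wt_lattice_le {R E : ℝ} (hR : 0 < R) (hE : (Fintype.card ι : ℝ) < E) (a : ι → ℝ)
    (K : Finset (ι → ℤ)) (x : ι → ℝ) :
    ∑ k ∈ K, wt (latticeCenter a R k) R E x ≤ (3 / 2) ^ E * wtMass ι E := by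
  classical
  unfold latticeCenter
  have hinj := latticeCorner_injective (a := a) hR
  have hdisj : ((K.image (latticeCorner a R) : Finset (ι → ℝ)) : Set (ι → ℝ)).PairwiseDisjoint
      fun b => box b R := by
    intro b hb b' hb' hbb'
    obtain ⟨k, -, rfl⟩ := Finset.mem_image.1 hb
    obtain ⟨k', -, rfl⟩ := Finset.mem_image.1 hb'
    have hkk' : k ≠ k' := fun h => hbb' (by rw [h])
    exact pairwise_disjoint_latticeBox hR hkk'
  have h := sum_wt_le_of_pairwiseDisjoint hR hE (K.image (latticeCorner a R)) hdisj x
  rwa [Finset.sum_image fun k _ k' _ hkk' => hinj hkk'] at h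

/-- Lattice sums of weights converge (`E > d`). [folklore] -/
theorem summable_wt_lattice {R E : ℝ} (hR : 0 < R) (hE : (Fintype.card ι : ℝ) < E) (a : ι → ℝ)
    (x : ι → ℝ) : Summable fun k : ι → ℤ => wt (latticeCenter a R k) R E x :=
  summable_of_sum_le (fun _ => wt_nonneg hR _ E x) fun K => sum_wt_lattice_le hR hE a K x

/-- `∑_{k ∈ ℤ^d} w_{Q_k,E}(x) ≤ (3/2)^E · wtMass` for the lattice tiling. [cite: Demeter2019, (9.7)] -/
theorem tsum_wt_lattice_le {R E : ℝ} (hR : 0 < R) (hE : (Fintype.card ι : ℝ) < E) (a : ι → ℝ)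
    (x : ι → ℝ) : ∑' k : ι → ℤ, wt (latticeCenter a R k) R E x ≤ (3 / 2) ^ E * wtMass ι E :=
  Real.tsum_le_of_sum_le (fun _ => wt_nonneg hR _ E x) fun K => sum_wt_lattice_le hR hE a K x

/-! ### The partition of a box of side `N R` into `N^d` boxes of side `R`: (9.7) -/

/-- `(9.7)`, first half: `1_Q ≤ (3/2)^E ∑_{Δ ⊂ Q} w_Δ` for the partition of `Q = box a (N R)`
into the `N^d` boxes `subbox a R N k`. [cite: Demeter2019, (9.7)] -/
theorem one_le_mul_sum_wt_subbox [DecidableEq ι] {R E : ℝ} (hR : 0 < R) (hE : 0 ≤ E) {N : ℕ}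
    {a x : ι → ℝ} (hx : x ∈ box a (N * R)) :
    1 ≤ (3 / 2) ^ E * ∑ k : ι → Fin N, wt (subboxCenter a R N k) R E x := by
  obtain ⟨k, hk⟩ := exists_mem_subbox hR hx
  have h1 : (1 + 1 / 2 : ℝ) ^ (-E) ≤ wt (subboxCenter a R N k) R E x :=
    rpow_neg_le_wt_of_dist_le hR hE (dist_boxCenter_le' hR.le hk)
  have h2 : wt (subboxCenter a R N k) R E x ≤ ∑ k : ι → Fin N, wt (subboxCenter a R N k) R E x :=
    Finset.single_le_sum (fun _ _ => wt_nonneg hR _ E x) (Finset.mem_univ k)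
  have h3 : (3 / 2 : ℝ) ^ E * (1 + 1 / 2 : ℝ) ^ (-E) = 1 := by
    rw [show (1 + 1 / 2 : ℝ) = 3 / 2 by norm_num, ← Real.rpow_add (by norm_num), add_neg_cancel,
      Real.rpow_zero]
  calc (1 : ℝ) = (3 / 2 : ℝ) ^ E * (1 + 1 / 2 : ℝ) ^ (-E) := h3.symm
    _ ≤ (3 / 2) ^ E * ∑ k : ι → Fin N, wt (subboxCenter a R N k) R E x :=
        mul_le_mul_of_nonneg_left (h1.trans h2) (Real.rpow_nonneg (by norm_num) _)

/-- The uniform bound for the sub-boxes of one box. [cite: Demeter2019, (9.7)] -/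
theorem sum_wt_subbox_le_wtMass [DecidableEq ι] {R E : ℝ} (hR : 0 < R)
    (hE : (Fintype.card ι : ℝ) < E) (N : ℕ) (a x : ι → ℝ) :
    ∑ k : ι → Fin N, wt (subboxCenter a R N k) R E x ≤ (3 / 2) ^ E * wtMass ι E := by
  classical
  have hinj : Function.Injective fun (k : ι → Fin N) (i : ι) => ((k i : ℕ) : ℤ) := by
    intro k k' h; funext i
    have := congr_fun h i
    dsimp only at this
    exact Fin.ext (by exact_mod_cast this)
  simp_rw [subboxCenter_eq_latticeCenter]
  rw [← Finset.sum_image (f := fun k' => wt (latticeCenter a R k') R E x)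
    (fun k _ k' _ h => hinj h)]
  exact sum_wt_lattice_le hR hE a _ x

/-- `(9.7)`, second half: `∑_{Δ ⊂ Q} w_{Δ,E}(x) ≤ K · w_{Q,E}(x)` with
`K = 2^E (3/2)^E wtMass + 4^E`, for the partition of `Q = box a (N R)` (`E > d`).
[cite: Demeter2019, (9.7)] -/
theorem sum_wt_subbox_le [DecidableEq ι] {R E : ℝ} (hR : 0 < R) (hE : (Fintype.card ι : ℝ) < E)
    {N : ℕ} (hN : 0 < N) (a x : ι → ℝ) :
    ∑ k : ι → Fin N, wt (subboxCenter a R N k) R E x ≤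
      (2 ^ E * ((3 / 2) ^ E * wtMass ι E) + 4 ^ E) * wt (boxCenter a (N * R)) (N * R) E x := by
  have hE0 : 0 ≤ E := ((Nat.cast_nonneg _).trans_lt hE).le
  have hN0 : (0 : ℝ) < N := by exact_mod_cast hN
  have hNR : 0 < (N : ℝ) * R := mul_pos hN0 hR
  set C := boxCenter a (N * R) with hC
  have hwQ : 0 ≤ wt C (N * R) E x := wt_nonneg hNR C E x
  have hK1 : 0 ≤ 2 ^ E * ((3 / 2) ^ E * wtMass ι E) := by
    have := wtMass_nonneg (ι := ι) E; positivity
  have hK2 : (0 : ℝ) ≤ 4 ^ E := by positivity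
  rcases lt_or_ge (dist x C) (N * R) with hnear | hfar
  · -- near regime: `w_Q(x) ≥ 2^{-E}`
    have hlow : (1 + 1 : ℝ) ^ (-E) ≤ wt C (N * R) E x :=
      rpow_neg_le_wt_of_dist_le hNR hE0 (by rw [one_mul]; exact hnear.le)
    norm_num at hlow
    have h2 : (2 : ℝ) ^ E * (2 : ℝ) ^ (-E) = 1 := by
      rw [← Real.rpow_add two_pos, add_neg_cancel, Real.rpow_zero]
    calc ∑ k : ι → Fin N, wt (subboxCenter a R N k) R E x
        ≤ (3 / 2) ^ E * wtMass ι E := sum_wt_subbox_le_wtMass hR hE N a x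
      _ = 2 ^ E * ((3 / 2) ^ E * wtMass ι E) * (2 : ℝ) ^ (-E) := by
          rw [mul_comm ((2 : ℝ) ^ E) _, mul_assoc, h2, mul_one]
      _ ≤ 2 ^ E * ((3 / 2) ^ E * wtMass ι E) * wt C (N * R) E x :=
          mul_le_mul_of_nonneg_left hlow hK1
      _ ≤ _ := by rw [add_mul]; linarith [mul_nonneg hK2 hwQ]
  · -- far regime: each term is `≤ (4/N)^E w_Q(x)`
    have hN1 : (1 : ℝ) ≤ N := by exact_mod_cast hN
    set s := dist x C with hs
    have hterm : ∀ k : ι → Fin N,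
        wt (subboxCenter a R N k) R E x ≤ ((N : ℝ) / 4) ^ (-E) * wt C (N * R) E x := by
      intro k
      have hd : dist (subboxCenter a R N k) C ≤ N * R / 2 :=
        dist_subboxCenter_boxCenter_le hR.le hN a k
      have h1 : s / 2 ≤ dist x (subboxCenter a R N k) := by
        have := dist_triangle x (subboxCenter a R N k) C
        linarith
      have hb : (N : ℝ) / 4 * (1 + s / (N * R)) ≤ 1 + dist x (subboxCenter a R N k) / R := by
        rw [← sub_nonneg]
        have e : 1 + dist x (subboxCenter a R N k) / R - (N : ℝ) / 4 * (1 + s / (N * R)) =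
            (4 * R + 4 * dist x (subboxCenter a R N k) - N * R - s) / (4 * R) := by
          field_simp
          ring
        rw [e]
        exact div_nonneg (by nlinarith) (by positivity)
      have key : (1 + dist x (subboxCenter a R N k) / R) ^ (-E) ≤
          ((N : ℝ) / 4 * (1 + s / (N * R))) ^ (-E) :=
        Real.rpow_le_rpow_of_nonpos (by positivity) hb (neg_nonpos.mpr hE0)
      rw [Real.mul_rpow (by positivity) (by positivity)] at key
      exact key
    have hpow : (N : ℝ) ^ Fintype.card ι * ((N : ℝ) / 4) ^ (-E) ≤ 4 ^ E := by
      have e1 : ((N : ℝ) / 4) ^ (-E) = 4 ^ E * (N : ℝ) ^ (-E) := by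
        rw [Real.div_rpow hN0.le (by norm_num), Real.rpow_neg (by norm_num : (0 : ℝ) ≤ 4),
          div_eq_mul_inv, inv_inv, mul_comm]
      have e2 : (N : ℝ) ^ Fintype.card ι * (N : ℝ) ^ (-E) = (N : ℝ) ^ ((Fintype.card ι : ℝ) - E) := by
        rw [← Real.rpow_natCast, ← Real.rpow_add hN0, sub_eq_add_neg]
      have e3 : (N : ℝ) ^ ((Fintype.card ι : ℝ) - E) ≤ 1 :=
        Real.rpow_le_one_of_one_le_of_nonpos hN1 (by linarith)
      calc (N : ℝ) ^ Fintype.card ι * ((N : ℝ) / 4) ^ (-E)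
          = 4 ^ E * ((N : ℝ) ^ Fintype.card ι * (N : ℝ) ^ (-E)) := by rw [e1]; ring
        _ = 4 ^ E * (N : ℝ) ^ ((Fintype.card ι : ℝ) - E) := by rw [e2]
        _ ≤ 4 ^ E * 1 := mul_le_mul_of_nonneg_left e3 hK2
        _ = 4 ^ E := mul_one _
    calc ∑ k : ι → Fin N, wt (subboxCenter a R N k) R E x
        ≤ ∑ _k : ι → Fin N, ((N : ℝ) / 4) ^ (-E) * wt C (N * R) E x :=
          Finset.sum_le_sum fun k _ => hterm k
      _ = (N : ℝ) ^ Fintype.card ι * ((N : ℝ) / 4) ^ (-E) * wt C (N * R) E x := by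
          rw [Finset.sum_const, Finset.card_univ, Fintype.card_fun, Fintype.card_fin, nsmul_eq_mul]
          push_cast
          ring
      _ ≤ 4 ^ E * wt C (N * R) E x := mul_le_mul_of_nonneg_right hpow hwQ
      _ ≤ _ := by rw [add_mul]; linarith [mul_nonneg hK1 hwQ]

/-! ### `(7.5)`, second half: `∑_{Q'} w_{Q'}(x) w_Q(c_{Q'}) ≲ w_Q(x)` -/

/-- Pointwise: for centres `c` (of `Q`, radius `R`) and `c'`:
`w_{c'}(x) w_c(c') ≤ 2^E w_c(x) (w_{c'}(x) + w_c(c'))`. [cite: Demeter2019, (7.5)] -/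
theorem wt_mul_wt_center_le {R E : ℝ} (hR : 0 < R) (hE : 0 ≤ E) (c c' x : ι → ℝ) :
    wt c' R E x * wt c R E c' ≤ 2 ^ E * wt c R E x * (wt c' R E x + wt c R E c') := by
  set s := dist x c with hs
  have hs0 : 0 ≤ s := dist_nonneg
  have hw1 := wt_nonneg hR c' E x
  have hw2 := wt_nonneg hR c E c'
  have hwx := wt_nonneg hR c E x
  have h2E : (0 : ℝ) ≤ 2 ^ E := by positivity
  have hhalf : ∀ {u : ℝ}, 0 ≤ u → s / 2 ≤ u → (1 + u / R) ^ (-E) ≤ 2 ^ E * wt c R E x := by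
    intro u hu0 hu
    have hb : 1 / 2 * (1 + s / R) ≤ 1 + u / R := by
      rw [← sub_nonneg]
      have e : 1 + u / R - 1 / 2 * (1 + s / R) = (R + 2 * u - s) / (2 * R) := by
        field_simp
        ring
      rw [e]
      exact div_nonneg (by linarith) (by positivity)
    have key : (1 + u / R) ^ (-E) ≤ (1 / 2 * (1 + s / R)) ^ (-E) :=
      Real.rpow_le_rpow_of_nonpos (by positivity) hb (neg_nonpos.mpr hE)
    rw [Real.mul_rpow (by norm_num) (by positivity), one_div,
      Real.inv_rpow (by norm_num : (0 : ℝ) ≤ 2), Real.rpow_neg (by norm_num : (0 : ℝ) ≤ 2),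
      inv_inv] at key
    rw [wt_def, ← hs]
    exact key
  rcases le_total (s / 2) (dist c' c) with hA | hB
  · -- `w_c(c') ≤ 2^E w_c(x)`
    have h1 : wt c R E c' ≤ 2 ^ E * wt c R E x := hhalf dist_nonneg hA
    calc wt c' R E x * wt c R E c' ≤ wt c' R E x * (2 ^ E * wt c R E x) :=
          mul_le_mul_of_nonneg_left h1 hw1
      _ ≤ wt c' R E x * (2 ^ E * wt c R E x) + wt c R E c' * (2 ^ E * wt c R E x) :=
          le_add_of_nonneg_right (mul_nonneg hw2 (mul_nonneg h2E hwx))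
      _ = 2 ^ E * wt c R E x * (wt c' R E x + wt c R E c') := by ring
  · have hB' : s / 2 ≤ dist x c' := by
      have := dist_triangle x c' c
      linarith
    have h1 : wt c' R E x ≤ 2 ^ E * wt c R E x := hhalf dist_nonneg hB'
    calc wt c' R E x * wt c R E c' ≤ 2 ^ E * wt c R E x * wt c R E c' :=
          mul_le_mul_of_nonneg_right h1 hw2
      _ ≤ 2 ^ E * wt c R E x * wt c R E c' + 2 ^ E * wt c R E x * wt c' R E x :=
          le_add_of_nonneg_right (mul_nonneg (mul_nonneg h2E hwx) hw1)
      _ = 2 ^ E * wt c R E x * (wt c' R E x + wt c R E c') := by ring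

/-- `(7.5)`, second half, finite form: `∑_{k ∈ K} w_{Q_k}(x) w_Q(c_k) ≤ 2^{E+1}(3/2)^E wtMass · w_Q(x)`
for lattice boxes `Q_k` of side `R` and any `Q` of radius `R`. [cite: Demeter2019, (7.5)] -/
theorem sum_wt_mul_wt_center_le {R E : ℝ} (hR : 0 < R) (hE : (Fintype.card ι : ℝ) < E)
    (a c : ι → ℝ) (K : Finset (ι → ℤ)) (x : ι → ℝ) :
    ∑ k ∈ K, wt (latticeCenter a R k) R E x * wt c R E (latticeCenter a R k) ≤
      2 * 2 ^ E * ((3 / 2) ^ E * wtMass ι E) * wt c R E x := by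
  have hE0 : 0 ≤ E := ((Nat.cast_nonneg _).trans_lt hE).le
  have h1 : ∀ k ∈ K, wt (latticeCenter a R k) R E x * wt c R E (latticeCenter a R k) ≤
      2 ^ E * wt c R E x * (wt (latticeCenter a R k) R E x + wt c R E (latticeCenter a R k)) :=
    fun k _ => wt_mul_wt_center_le hR hE0 c _ x
  refine (Finset.sum_le_sum h1).trans ?_
  rw [← Finset.mul_sum, Finset.sum_add_distrib]
  have hA := sum_wt_lattice_le hR hE a K x
  have hB : ∑ k ∈ K, wt c R E (latticeCenter a R k) ≤ (3 / 2) ^ E * wtMass ι E := by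
    simp_rw [wt_comm c]
    exact sum_wt_lattice_le hR hE a K c
  have hw := wt_nonneg hR c E x
  have h2E : (0 : ℝ) ≤ 2 ^ E := by positivity
  have h2w : 0 ≤ 2 ^ E * wt c R E x := mul_nonneg h2E hw
  calc 2 ^ E * wt c R E x *
        (∑ k ∈ K, wt (latticeCenter a R k) R E x + ∑ k ∈ K, wt c R E (latticeCenter a R k))
      ≤ 2 ^ E * wt c R E x * ((3 / 2) ^ E * wtMass ι E + (3 / 2) ^ E * wtMass ι E) :=
        mul_le_mul_of_nonneg_left (add_le_add hA hB) h2w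
    _ = 2 * 2 ^ E * ((3 / 2) ^ E * wtMass ι E) * wt c R E x := by ring

/-- The series in `(7.5)` converges (`E > d`). [folklore] -/
theorem summable_wt_mul_wt_center {R E : ℝ} (hR : 0 < R) (hE : (Fintype.card ι : ℝ) < E)
    (a c : ι → ℝ) (x : ι → ℝ) :
    Summable fun k : ι → ℤ => wt (latticeCenter a R k) R E x * wt c R E (latticeCenter a R k) :=
  summable_of_sum_le (fun _ => mul_nonneg (wt_nonneg hR _ E x) (wt_nonneg hR c E _))
    fun K => sum_wt_mul_wt_center_le hR hE a c K x

/-- `(7.5)`, second half: `∑_{k ∈ ℤ^d} w_{Q_k}(x) w_Q(c_k) ≤ 2^{E+1}(3/2)^E wtMass · w_Q(x)`.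
[cite: Demeter2019, (7.5)] -/
theorem tsum_wt_mul_wt_center_le {R E : ℝ} (hR : 0 < R) (hE : (Fintype.card ι : ℝ) < E)
    (a c : ι → ℝ) (x : ι → ℝ) :
    ∑' k : ι → ℤ, wt (latticeCenter a R k) R E x * wt c R E (latticeCenter a R k) ≤
      2 * 2 ^ E * ((3 / 2) ^ E * wtMass ι E) * wt c R E x :=
  Real.tsum_le_of_sum_le (fun _ => mul_nonneg (wt_nonneg hR _ E x) (wt_nonneg hR c E _))
    fun K => sum_wt_mul_wt_center_le hR hE a c K x

/-! ### Integrated forms (the ingredients of Demeter's Lemma 9.12) -/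

/-- The weight as an `ℝ≥0∞`-valued density. [folklore] -/
def wtE (c : ι → ℝ) (R E : ℝ) (x : ι → ℝ) : ℝ≥0∞ := ENNReal.ofReal (wt c R E x)

/-- Unfolding the `ℝ≥0∞` weight. [folklore] -/
theorem wtE_def (c : ι → ℝ) (R E : ℝ) (x : ι → ℝ) : wtE c R E x = ENNReal.ofReal (wt c R E x) :=
  rfl

/-- The `ℝ≥0∞` weight is measurable. [folklore] -/
theorem measurable_wtE {R : ℝ} (hR : 0 < R) (c : ι → ℝ) (E : ℝ) : Measurable (wtE c R E) :=
  ENNReal.measurable_ofReal.comp (measurable_wt hR c E)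

/-- The `ℝ≥0∞` weight is finite. [folklore] -/
theorem wtE_ne_top (c : ι → ℝ) (R E : ℝ) (x : ι → ℝ) : wtE c R E x ≠ ∞ := ENNReal.ofReal_ne_top

/-- `∫ G = ∑_k ∫_{Q_k} G` over the lattice tiling. [folklore] -/
theorem lintegral_eq_tsum_latticeBox {R : ℝ} (hR : 0 < R) (a : ι → ℝ) (G : (ι → ℝ) → ℝ≥0∞) :
    ∫⁻ x, G x = ∑' k : ι → ℤ, ∫⁻ x in latticeBox a R k, G x := by
  calc ∫⁻ x, G x = ∫⁻ x in ⋃ k, latticeBox a R k, G x := by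
        rw [iUnion_latticeBox hR, Measure.restrict_univ]
    _ = ∑' k : ι → ℤ, ∫⁻ x in latticeBox a R k, G x :=
        lintegral_iUnion (measurableSet_latticeBox a R) (pairwise_disjoint_latticeBox hR) G

/-- `(9.7)`, first half, integrated: `∫_Q G ≤ (3/2)^E ∑_{Δ ⊂ Q} ∫ G w_Δ` for the partition of
`Q = box a (N R)`. [cite: Demeter2019, (9.7)] -/
theorem lintegral_box_le_sum [DecidableEq ι] {R E : ℝ} (hR : 0 < R) (hE : 0 ≤ E) (N : ℕ)
    (a : ι → ℝ) {G : (ι → ℝ) → ℝ≥0∞} (hG : Measurable G) :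
    ∫⁻ x in box a (N * R), G x ≤
      ENNReal.ofReal ((3 / 2) ^ E) *
        ∑ k : ι → Fin N, ∫⁻ x, G x * wtE (subboxCenter a R N k) R E x := by
  have hmeas : ∀ k : ι → Fin N, Measurable fun x => G x * wtE (subboxCenter a R N k) R E x :=
    fun k => hG.mul (measurable_wtE hR _ E)
  have hpt : ∀ x ∈ box a (N * R), G x ≤
      ENNReal.ofReal ((3 / 2) ^ E) * ∑ k : ι → Fin N, G x * wtE (subboxCenter a R N k) R E x := by
    intro x hx
    have h1 := one_le_mul_sum_wt_subbox hR hE hx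
    have h2 : (1 : ℝ≥0∞) ≤
        ENNReal.ofReal ((3 / 2) ^ E) * ∑ k : ι → Fin N, wtE (subboxCenter a R N k) R E x := by
      simp only [wtE]
      rw [← ENNReal.ofReal_one, ← ENNReal.ofReal_sum_of_nonneg (fun k _ => wt_nonneg hR _ E x),
        ← ENNReal.ofReal_mul (by positivity)]
      exact ENNReal.ofReal_le_ofReal h1
    have h3 : ENNReal.ofReal ((3 / 2) ^ E) * ∑ k : ι → Fin N, G x * wtE (subboxCenter a R N k) R E x
        = G x * (ENNReal.ofReal ((3 / 2) ^ E) * ∑ k : ι → Fin N, wtE (subboxCenter a R N k) R E x) := by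
      rw [Finset.mul_sum, Finset.mul_sum, Finset.mul_sum]
      refine Finset.sum_congr rfl fun k _ => ?_
      ring
    rw [h3]
    calc G x = G x * 1 := (mul_one _).symm
      _ ≤ _ := mul_le_mul_right h2 _
  calc ∫⁻ x in box a (N * R), G x
      ≤ ∫⁻ x in box a (N * R), ENNReal.ofReal ((3 / 2) ^ E) *
          ∑ k : ι → Fin N, G x * wtE (subboxCenter a R N k) R E x :=
        setLIntegral_mono' (measurableSet_box a _) hpt
    _ ≤ ∫⁻ x, ENNReal.ofReal ((3 / 2) ^ E) *
          ∑ k : ι → Fin N, G x * wtE (subboxCenter a R N k) R E x :=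
        setLIntegral_le_lintegral _ _
    _ = ENNReal.ofReal ((3 / 2) ^ E) *
          ∫⁻ x, ∑ k : ι → Fin N, G x * wtE (subboxCenter a R N k) R E x :=
        lintegral_const_mul _ (Finset.measurable_sum _ fun k _ => hmeas k)
    _ = _ := by rw [lintegral_finsetSum _ fun k _ => hmeas k]

/-- `(9.7)`, second half, integrated: `∑_{Δ ⊂ Q} ∫ G w_Δ ≤ K ∫ G w_Q`. [cite: Demeter2019, (9.7)] -/
theorem sum_lintegral_wt_subbox_le [DecidableEq ι] {R E : ℝ} (hR : 0 < R)
    (hE : (Fintype.card ι : ℝ) < E) {N : ℕ} (hN : 0 < N) (a : ι → ℝ) {G : (ι → ℝ) → ℝ≥0∞}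
    (hG : Measurable G) :
    ∑ k : ι → Fin N, ∫⁻ x, G x * wtE (subboxCenter a R N k) R E x ≤
      ENNReal.ofReal (2 ^ E * ((3 / 2) ^ E * wtMass ι E) + 4 ^ E) *
        ∫⁻ x, G x * wtE (boxCenter a (N * R)) (N * R) E x := by
  have hmeas : ∀ k : ι → Fin N, Measurable fun x => G x * wtE (subboxCenter a R N k) R E x :=
    fun k => hG.mul (measurable_wtE hR _ E)
  rw [← lintegral_finsetSum _ fun k _ => hmeas k, ← lintegral_const_mul' _ _ ENNReal.ofReal_ne_top]
  refine lintegral_mono fun x => ?_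
  rw [← Finset.mul_sum, mul_left_comm]
  refine mul_le_mul_right ?_ _
  simp only [wtE]
  rw [← ENNReal.ofReal_sum_of_nonneg (fun k _ => wt_nonneg hR _ E x), ← ENNReal.ofReal_mul ?_]
  · exact ENNReal.ofReal_le_ofReal (sum_wt_subbox_le hR hE hN a x)
  · have := wtMass_nonneg (ι := ι) E; positivity

/-- `(7.5)`, first half, integrated over the lattice tiling of side `R`:
`∫ G w_Q ≤ (3/2)^E ∑_k w_Q(c_k) ∫_{Q_k} G` (`Q` of radius `R`, any centre `c`).
[cite: Demeter2019, (7.5)] -/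
theorem lintegral_wt_le_tsum {R E : ℝ} (hR : 0 < R) (hE : 0 ≤ E) (a c : ι → ℝ)
    (G : (ι → ℝ) → ℝ≥0∞) :
    ∫⁻ x, G x * wtE c R E x ≤
      ENNReal.ofReal ((3 / 2) ^ E) *
        ∑' k : ι → ℤ, wtE c R E (latticeCenter a R k) * ∫⁻ x in latticeBox a R k, G x := by
  rw [lintegral_eq_tsum_latticeBox hR a, ← ENNReal.tsum_mul_left]
  refine ENNReal.tsum_le_tsum fun k => ?_
  have hpt : ∀ x ∈ latticeBox a R k, G x * wtE c R E x ≤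
      G x * (ENNReal.ofReal ((3 / 2) ^ E) * wtE c R E (latticeCenter a R k)) := by
    intro x hx
    refine mul_le_mul_right ?_ _
    rw [wtE, wtE, ← ENNReal.ofReal_mul (by positivity)]
    exact ENNReal.ofReal_le_ofReal (wt_le_mul_wt_center_of_mem_box hR hE c hx)
  calc ∫⁻ x in latticeBox a R k, G x * wtE c R E x
      ≤ ∫⁻ x in latticeBox a R k, G x * (ENNReal.ofReal ((3 / 2) ^ E) * wtE c R E (latticeCenter a R k)) :=
        setLIntegral_mono' (measurableSet_latticeBox a R k) hpt
    _ = (∫⁻ x in latticeBox a R k, G x) * (ENNReal.ofReal ((3 / 2) ^ E) * wtE c R E (latticeCenter a R k)) :=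
        lintegral_mul_const' (ENNReal.ofReal ((3 / 2) ^ E) * wtE c R E (latticeCenter a R k))
          (fun x => G x) (ENNReal.mul_ne_top ENNReal.ofReal_ne_top (wtE_ne_top _ _ _ _))
    _ = _ := by ring

/-- `(7.5)`, second half, integrated: `∑_k w_Q(c_k) ∫ G w_{Q_k} ≤ K' ∫ G w_Q` with
`K' = 2^{E+1}(3/2)^E wtMass`. [cite: Demeter2019, (7.5)] -/
theorem tsum_wt_center_mul_lintegral_le {R E : ℝ} (hR : 0 < R) (hE : (Fintype.card ι : ℝ) < E)
    (a c : ι → ℝ) {G : (ι → ℝ) → ℝ≥0∞} (hG : Measurable G) :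
    ∑' k : ι → ℤ, wtE c R E (latticeCenter a R k) * ∫⁻ x, G x * wtE (latticeCenter a R k) R E x ≤
      ENNReal.ofReal (2 * 2 ^ E * ((3 / 2) ^ E * wtMass ι E)) * ∫⁻ x, G x * wtE c R E x := by
  have hmeas : ∀ k : ι → ℤ, Measurable fun x => G x * wtE (latticeCenter a R k) R E x :=
    fun k => hG.mul (measurable_wtE hR _ E)
  have h1 : ∀ k : ι → ℤ,
      wtE c R E (latticeCenter a R k) * ∫⁻ x, G x * wtE (latticeCenter a R k) R E x =
        ∫⁻ x, G x * wtE (latticeCenter a R k) R E x * wtE c R E (latticeCenter a R k) := by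
    intro k
    rw [mul_comm, lintegral_mul_const _ (hmeas k)]
  simp_rw [h1]
  rw [← lintegral_tsum fun k => ((hmeas k).mul_const _).aemeasurable,
    ← lintegral_const_mul' _ _ ENNReal.ofReal_ne_top]
  refine lintegral_mono fun x => ?_
  simp_rw [mul_assoc]
  rw [ENNReal.tsum_mul_left, mul_left_comm]
  refine mul_le_mul_right ?_ _
  have hsum := summable_wt_mul_wt_center hR hE a c x
  have hnn : ∀ k : ι → ℤ, 0 ≤ wt (latticeCenter a R k) R E x * wt c R E (latticeCenter a R k) :=
    fun k => mul_nonneg (wt_nonneg hR _ E x) (wt_nonneg hR c E _)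
  simp only [wtE]
  simp_rw [← ENNReal.ofReal_mul (wt_nonneg hR _ E x)]
  rw [← ENNReal.ofReal_tsum_of_nonneg hnn hsum, ← ENNReal.ofReal_mul ?_]
  · exact ENNReal.ofReal_le_ofReal ((tsum_wt_mul_wt_center_le hR hE a c x).trans_eq (by ring))
  · have := wtMass_nonneg (ι := ι) E; positivity

/-! ### Demeter's Lemma 9.12: from sharp cubes to weights -/

/-- **Minkowski's inequality for finitely many `ℝ≥0∞`-valued sequences** (iterated
`ENNReal.Lp_add_le`): `(∑_k (∑_i x_{ik})^r)^{1/r} ≤ ∑_i (∑_k x_{ik}^r)^{1/r}` for `r ≥ 1`.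
[folklore] -/
theorem rpow_sum_sum_le {β κ : Type*} (K : Finset β) (I : Finset κ) (x : κ → β → ℝ≥0∞) {r : ℝ}
    (hr : 1 ≤ r) :
    (∑ k ∈ K, (∑ i ∈ I, x i k) ^ r) ^ (1 / r) ≤ ∑ i ∈ I, (∑ k ∈ K, x i k ^ r) ^ (1 / r) := by
  classical
  have hr0 : 0 < r := one_pos.trans_le hr
  induction I using Finset.induction_on with
  | empty => simp [ENNReal.zero_rpow_of_pos hr0, hr0]
  | insert j I hj IH =>
    simp_rw [Finset.sum_insert hj]
    calc (∑ k ∈ K, (x j k + ∑ i ∈ I, x i k) ^ r) ^ (1 / r)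
        ≤ (∑ k ∈ K, x j k ^ r) ^ (1 / r) + (∑ k ∈ K, (∑ i ∈ I, x i k) ^ r) ^ (1 / r) :=
          ENNReal.Lp_add_le K (x j) (fun k => ∑ i ∈ I, x i k) hr
      _ ≤ _ := by gcongr

/-- The same without the outer roots: `∑_k (∑_i x_{ik})^r ≤ (∑_i (∑_k x_{ik}^r)^{1/r})^r`.
[folklore] -/
theorem sum_rpow_sum_le {β κ : Type*} (K : Finset β) (I : Finset κ) (x : κ → β → ℝ≥0∞) {r : ℝ}
    (hr : 1 ≤ r) :
    ∑ k ∈ K, (∑ i ∈ I, x i k) ^ r ≤ (∑ i ∈ I, (∑ k ∈ K, x i k ^ r) ^ (1 / r)) ^ r := by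
  have hr0 : 0 < r := one_pos.trans_le hr
  have h := ENNReal.rpow_le_rpow (rpow_sum_sum_le K I x hr) hr0.le
  rwa [← ENNReal.rpow_mul, one_div_mul_cancel hr0.ne', ENNReal.rpow_one] at h

/-- Homogeneity of `a ↦ (∑_i a_i^q)^r` when `q r = 1`. [folklore] -/
theorem mul_rpow_sum_rpow {κ : Type*} (I : Finset κ) (a : κ → ℝ≥0∞) (w : ℝ≥0∞) {q r : ℝ}
    (hq : 0 ≤ q) (hr : 0 ≤ r) (hqr : q * r = 1) :
    w * (∑ i ∈ I, a i ^ q) ^ r = (∑ i ∈ I, (w * a i) ^ q) ^ r := by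
  simp_rw [ENNReal.mul_rpow_of_nonneg _ _ hq]
  rw [← Finset.mul_sum, ENNReal.mul_rpow_of_nonneg _ _ hr, ← ENNReal.rpow_mul, hqr,
    ENNReal.rpow_one]

/-- **Demeter's Lemma 9.12 / study guide Lemma 4.1 (concrete form).** Let `p ≥ 2`, `E > d`,
`R > 0`, a measurable `Φ ≥ 0` (think `|F|^p`) and finitely many measurable `Ψ_i ≥ 0` (think
`|F_i|^p`). If for every lattice cube `Q'` of side `R` (corners `a + R ℤ^d`)
`∫_{Q'} Φ ≤ C (∑_i (∫ Ψ_i w_{Q',E})^{2/p})^{p/2}` — hypothesis (W1) for `O₁(v) = ∫ Φ v` and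
`O₂(v) = (∑_i (∫ Ψ_i v)^{2/p})^{p/2}` — then for every cube `Q` of side `R`
`∫ Φ w_{Q,E} ≤ K C (∑_i (∫ Ψ_i w_{Q,E})^{2/p})^{p/2}` with `K = (3/2)^E · 2^{E+1}(3/2)^E wtMass`
depending only on `E, d`. [cite: Demeter2019, Lemma 9.12 with Remark 9.13] -/
theorem lintegral_wt_le_of_forall_latticeBox {R E p : ℝ} (hR : 0 < R)
    (hE : (Fintype.card ι : ℝ) < E) (hp : 2 ≤ p) (a : ι → ℝ) {Φ : (ι → ℝ) → ℝ≥0∞}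
    {κ : Type*} (I : Finset κ) {Ψ : κ → (ι → ℝ) → ℝ≥0∞} (hΨ : ∀ i, Measurable (Ψ i)) {C : ℝ≥0∞}
    (hW1 : ∀ k : ι → ℤ, ∫⁻ x in latticeBox a R k, Φ x ≤
      C * (∑ i ∈ I, (∫⁻ x, Ψ i x * wtE (latticeCenter a R k) R E x) ^ (2 / p)) ^ (p / 2))
    (c : ι → ℝ) :
    ∫⁻ x, Φ x * wtE c R E x ≤
      ENNReal.ofReal ((3 / 2) ^ E) * ENNReal.ofReal (2 * 2 ^ E * ((3 / 2) ^ E * wtMass ι E)) * C *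
        (∑ i ∈ I, (∫⁻ x, Ψ i x * wtE c R E x) ^ (2 / p)) ^ (p / 2) := by
  have hE0 : 0 ≤ E := ((Nat.cast_nonneg _).trans_lt hE).le
  -- exponents
  set r : ℝ := p / 2 with hr
  set q : ℝ := 2 / p with hq
  have hr1 : 1 ≤ r := by rw [hr, le_div_iff₀ two_pos]; linarith
  have hr0 : 0 < r := one_pos.trans_le hr1
  have hq0 : 0 ≤ q := by rw [hq]; positivity
  have hqr : q * r = 1 := by
    rw [hq, hr]; field_simp
  have hq' : q = 1 / r := by rw [hq, hr, one_div_div]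
  -- abbreviations
  set A : ℝ≥0∞ := ENNReal.ofReal ((3 / 2) ^ E) with hA
  set K' : ℝ≥0∞ := ENNReal.ofReal (2 * 2 ^ E * ((3 / 2) ^ E * wtMass ι E)) with hK'
  set w : (ι → ℤ) → ℝ≥0∞ := fun k => wtE c R E (latticeCenter a R k) with hw
  set b : κ → (ι → ℤ) → ℝ≥0∞ := fun i k => w k * ∫⁻ x, Ψ i x * wtE (latticeCenter a R k) R E x
    with hb
  set dd : κ → ℝ≥0∞ := fun i => ∫⁻ x, Ψ i x * wtE c R E x with hdd
  -- Step 1: cut `w_Q` along the tiling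
  have h1 : ∫⁻ x, Φ x * wtE c R E x ≤ A * ∑' k : ι → ℤ, w k * ∫⁻ x in latticeBox a R k, Φ x :=
    lintegral_wt_le_tsum hR hE0 a c Φ
  -- Step 2: hypothesis (W1) on each cube, and homogeneity
  have h2 : ∀ k : ι → ℤ, w k * ∫⁻ x in latticeBox a R k, Φ x ≤ C * (∑ i ∈ I, b i k ^ q) ^ r := by
    intro k
    calc w k * ∫⁻ x in latticeBox a R k, Φ x
        ≤ w k * (C * (∑ i ∈ I, (∫⁻ x, Ψ i x * wtE (latticeCenter a R k) R E x) ^ q) ^ r) :=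
          mul_le_mul_right (hW1 k) _
      _ = C * (w k * (∑ i ∈ I, (∫⁻ x, Ψ i x * wtE (latticeCenter a R k) R E x) ^ q) ^ r) := by
          ring
      _ = C * (∑ i ∈ I, b i k ^ q) ^ r := by rw [mul_rpow_sum_rpow I _ (w k) hq0 hr0.le hqr]
  -- Step 3: Minkowski in `ℓ^r(ℤ^d)` for the finitely many sequences `k ↦ b_{ik}^q`
  have h3 : ∑' k : ι → ℤ, (∑ i ∈ I, b i k ^ q) ^ r ≤ (∑ i ∈ I, (∑' k : ι → ℤ, b i k) ^ q) ^ r := by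
    rw [ENNReal.tsum_eq_iSup_sum]
    refine iSup_le fun K => ?_
    have hM := sum_rpow_sum_le K I (fun i k => b i k ^ q) hr1
    have hx : ∀ i k, (b i k ^ q) ^ r = b i k := fun i k => by
      rw [← ENNReal.rpow_mul, hqr, ENNReal.rpow_one]
    simp_rw [hx, ← hq'] at hM
    refine hM.trans (ENNReal.rpow_le_rpow (Finset.sum_le_sum fun i _ => ?_) hr0.le)
    exact ENNReal.rpow_le_rpow (ENNReal.sum_le_tsum _) hq0
  -- Step 4: `(7.5)` second half: `∑_k b_{ik} ≤ K' d_i`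
  have h4 : ∀ i, ∑' k : ι → ℤ, b i k ≤ K' * dd i := fun i =>
    tsum_wt_center_mul_lintegral_le hR hE a c (hΨ i)
  -- Step 5: assemble
  calc ∫⁻ x, Φ x * wtE c R E x
      ≤ A * ∑' k : ι → ℤ, w k * ∫⁻ x in latticeBox a R k, Φ x := h1
    _ ≤ A * ∑' k : ι → ℤ, C * (∑ i ∈ I, b i k ^ q) ^ r :=
        mul_le_mul_right (ENNReal.tsum_le_tsum h2) _
    _ = A * C * ∑' k : ι → ℤ, (∑ i ∈ I, b i k ^ q) ^ r := by rw [ENNReal.tsum_mul_left, mul_assoc]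
    _ ≤ A * C * (∑ i ∈ I, (∑' k : ι → ℤ, b i k) ^ q) ^ r := mul_le_mul_right h3 _
    _ ≤ A * C * (∑ i ∈ I, (K' * dd i) ^ q) ^ r := by
        gcongr with i hi
        · exact h4 i
    _ = A * C * (K' * (∑ i ∈ I, dd i ^ q) ^ r) := by rw [mul_rpow_sum_rpow I dd K' hq0 hr0.le hqr]
    _ = A * K' * C * (∑ i ∈ I, dd i ^ q) ^ r := by ring

end DecouplingWeights
end Literature.Analysis.Fourier
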